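import Mathlib
import HarnessLib
import Summits.NavierStokesRegularity.NavierStokesRegularity.Theorems.PoloidalWindowDoorLrcModEntireWebFunction
import Summits.NavierStokesRegularity.NavierStokesRegularity.Theorems.PoloidalWindowDoorLrcModEntireSheetFlattenTools

/-!
# Route `PoloidalWindowDoor`, item `LrcModEntire` (stmt-NavierStokesRegularity-20428), cell (Q4) of the (TH) column —
# THE WEB FUNCTION OF A STRAIGHT HOT BRANCH (class-free wiring tools for `stub_Q4line`, LEAD memo T2B-g16 §2/§6(iii))

Cell ns-regularity-ideate, LEAD-lineage seat ns-poloidal-K2-p3 g16 (`--supports stmt-NavierStokesRegularity-20428`).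

For a `C^ω` function `F₀ : ℝ³ → ℝ`, a horizontal unit vector `e` and the cross-sections `n ↦ F₀(s·e + n·Je + z·e₂)`
(`|n| ≤ r`, `|z| < δ`), each strictly concave on `(−r, r)` and carrying a unique strict maximiser `n₀(s,z) ∈ (−r, r)` with
height-only value `R(z)` (the web Fermat clause of the (Q4) package over a STRAIGHT branch):
* `line_frame` — for a unit-speed line `Γ s = s·Γ′(0)` in `P₀`: `Γ′ ≡ e`, `e₂ = 0`, `e₀² + e₁² = 1`, `ν_Γ ≡ Je`, and the
  cross-section points are `L_e(s,n,z)`;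
* `webFun` and `webFun_spec` — the web function `G(s,z) = n₀` (chosen), its range, value and uniqueness;
* `fderiv_Jvec_webFun_eq_zero` — `∂_νF₀ = 0` at the web point (interior maximum);
* `contDiffAt_webFun` — `G` is `C^ω` on the region `|z| < δ` (`…WebFunction.contDiffAt_criticalPoint`).

WHAT THIS IS NOT: not a claim about Navier–Stokes regularity; calculus (bears_on LADDER-NS N0 via item 20428).
-/

noncomputable section

set_option linter.dupNamespace false
set_option linter.unusedVariables false

namespace Summit.NavierStokesRegularity.NavierStokesRegularity.Theorems.PoloidalWindowDoorLrcModEntireQ4LineWeb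

open Set Function Filter Topology Metric
open scoped ContDiff
open Summit.NavierStokesRegularity.NavierStokesRegularity.Theorems.PoloidalWindowDoorLrcModEntireSheetCauchyUniqueness
open Summit.NavierStokesRegularity.NavierStokesRegularity.Theorems.PoloidalWindowDoorLrcModEntireSheetFlattenTools
open Summit.NavierStokesRegularity.NavierStokesRegularity.Theorems.PoloidalWindowDoorLrcModEntireWebFunction

/-! ### A. The frame of a straight unit-speed branch -/

/-- **Frame of a straight hot branch.**  If `Γ` is differentiable with `Γ s = s·Γ′(0)`, `Γ s ∈ P₀`, `‖Γ′ s‖ = 1` and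
`ν_Γ = (−Γ′₁, Γ′₀, 0)`, then with `e := Γ′(0)`: `Γ′ ≡ e`, `e₂ = 0`, `e₀² + e₁² = 1`, `ν_Γ ≡ Je` and
`Γ s + n·ν_Γ s + z·e₂ = L_e(s,n,z)`. -/
theorem line_frame {Γ νΓ : ℝ → EuclideanSpace ℝ (Fin 3)} (hline : ∀ s : ℝ, Γ s = s • deriv Γ 0)
    (hΓ2 : ∀ s, Γ s 2 = 0) (hunit : ∀ s, ‖deriv Γ s‖ = 1)
    (hν : ∀ s, νΓ s = WithLp.toLp 2 ![-(deriv Γ s 1), deriv Γ s 0, 0]) :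
    (∀ s, deriv Γ s = deriv Γ 0) ∧ deriv Γ 0 2 = 0 ∧ (deriv Γ 0) 0 ^ 2 + (deriv Γ 0) 1 ^ 2 = 1 ∧
      (∀ s, νΓ s = Jvec (deriv Γ 0)) ∧
      (∀ s n z : ℝ, Γ s + n • νΓ s + z • EuclideanSpace.single 2 (1 : ℝ) = frameCLM (deriv Γ 0) (s, n, z)) := by
  set e := deriv Γ 0 with he
  have hfun : Γ = fun s => s • e := funext hline
  have hderiv : ∀ s, deriv Γ s = e := by
    intro s
    rw [hfun]
    have h : HasDerivAt (fun s : ℝ => s • e) ((1 : ℝ) • e) s := (hasDerivAt_id s).smul_const e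
    rw [one_smul] at h
    exact h.deriv
  have he2 : e 2 = 0 := by
    have h1 := hΓ2 1
    rw [hline 1, one_smul] at h1
    exact h1
  have hsq : e 0 ^ 2 + e 1 ^ 2 = 1 := by
    have h := hunit 0
    rw [← he, EuclideanSpace.norm_eq] at h
    have h2 : (∑ i : Fin 3, ‖e i‖ ^ 2) = 1 := by
      have := congrArg (fun x : ℝ => x ^ 2) h
      simp only [one_pow] at this
      rwa [Real.sq_sqrt (Finset.sum_nonneg fun i _ => by positivity)] at this
    simp only [Fin.sum_univ_three, Real.norm_eq_abs, sq_abs, he2] at h2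
    linarith
  refine ⟨hderiv, he2, hsq, fun s => by rw [hν s, hderiv s]; rfl, fun s n z => ?_⟩
  rw [frameCLM_apply, hν s, hderiv s, hline s]
  rfl

/-! ### B. The web function -/

/-- The web function: the maximiser of the cross-section at `(s, z)` (chosen), `0` off the window. -/
def webFun (F₀ : EuclideanSpace ℝ (Fin 3) → ℝ) (e : EuclideanSpace ℝ (Fin 3)) (r δ : ℝ) (Rz : ℝ → ℝ)
    (hS : ∀ z : ℝ, |z| < δ → ∀ s : ℝ, ∃ n₀ ∈ Ioo (-r) r, F₀ (frameCLM e (s, n₀, z)) = Rz z ∧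
      ∀ n ∈ Icc (-r) r, n ≠ n₀ → F₀ (frameCLM e (s, n, z)) < Rz z) (p : ℝ × ℝ) : ℝ :=
  if h : |p.2| < δ then Classical.choose (hS p.2 h p.1) else 0

/-- The defining properties of the web function on the window. -/
theorem webFun_spec {F₀ : EuclideanSpace ℝ (Fin 3) → ℝ} {e : EuclideanSpace ℝ (Fin 3)} {r δ : ℝ} {Rz : ℝ → ℝ}
    (hS : ∀ z : ℝ, |z| < δ → ∀ s : ℝ, ∃ n₀ ∈ Ioo (-r) r, F₀ (frameCLM e (s, n₀, z)) = Rz z ∧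
      ∀ n ∈ Icc (-r) r, n ≠ n₀ → F₀ (frameCLM e (s, n, z)) < Rz z)
    {p : ℝ × ℝ} (hp : |p.2| < δ) :
    webFun F₀ e r δ Rz hS p ∈ Ioo (-r) r ∧ F₀ (frameCLM e (p.1, webFun F₀ e r δ Rz hS p, p.2)) = Rz p.2 ∧
      ∀ n ∈ Icc (-r) r, n ≠ webFun F₀ e r δ Rz hS p → F₀ (frameCLM e (p.1, n, p.2)) < Rz p.2 := by
  unfold webFun
  rw [dif_pos hp]
  exact ⟨(Classical.choose_spec (hS p.2 hp p.1)).1, (Classical.choose_spec (hS p.2 hp p.1)).2.1,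
    (Classical.choose_spec (hS p.2 hp p.1)).2.2⟩

/-- The cross-section family `(p, n) ↦ F₀(L_e(p.1, n, p.2))` as a function on `(ℝ × ℝ) × ℝ`. -/
def sectionFun (F₀ : EuclideanSpace ℝ (Fin 3) → ℝ) (e : EuclideanSpace ℝ (Fin 3)) (v : (ℝ × ℝ) × ℝ) : ℝ :=
  F₀ (frameCLM e (v.1.1, v.2, v.1.2))

/-- The reindexing `((s,z),n) ↦ (s,n,z)` as a continuous linear map. -/
def reindex : (ℝ × ℝ) × ℝ →L[ℝ] ℝ × ℝ × ℝ :=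
  ((ContinuousLinearMap.fst ℝ ℝ ℝ).comp (ContinuousLinearMap.fst ℝ (ℝ × ℝ) ℝ)).prod
    ((ContinuousLinearMap.snd ℝ (ℝ × ℝ) ℝ).prod ((ContinuousLinearMap.snd ℝ ℝ ℝ).comp (ContinuousLinearMap.fst ℝ (ℝ × ℝ) ℝ)))

/-- Auxiliary: `reindex` in coordinates. -/
theorem reindex_apply (v : (ℝ × ℝ) × ℝ) : reindex v = (v.1.1, v.2, v.1.2) := by
  simp [reindex]

/-- Auxiliary: `sectionFun` is `F₀` after the linear map `L_e ∘ reindex`. -/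
theorem sectionFun_eq (F₀ : EuclideanSpace ℝ (Fin 3) → ℝ) (e : EuclideanSpace ℝ (Fin 3)) :
    sectionFun F₀ e = F₀ ∘ ((frameCLM e).comp reindex) := by
  funext v; simp [sectionFun, reindex_apply, frameCLM_apply]

/-- First derivative of the cross-section family: `D(sectionFun)(v)[w] = DF₀(x)[L_e(reindex w)]`. -/
theorem fderiv_sectionFun {F₀ : EuclideanSpace ℝ (Fin 3) → ℝ} (hF : Differentiable ℝ F₀) (e : EuclideanSpace ℝ (Fin 3))
    (v w : (ℝ × ℝ) × ℝ) :
    fderiv ℝ (sectionFun F₀ e) v w = fderiv ℝ F₀ (frameCLM e (v.1.1, v.2, v.1.2)) (frameCLM e (w.1.1, w.2, w.1.2)) := by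
  rw [sectionFun_eq]
  have h := (hF _).hasFDerivAt.comp v ((frameCLM e).comp reindex).hasFDerivAt
  rw [h.fderiv]
  simp [reindex_apply]

/-- Nested second derivatives are values of the second Fréchet derivative (any real normed space). -/
theorem nested_eq_fderiv_fderiv' {E : Type*} [NormedAddCommGroup E] [NormedSpace ℝ E] {θ : E → ℝ}
    (hθ : ContDiff ℝ 2 θ) (x a b : E) :
    fderiv ℝ (fun y => fderiv ℝ θ y b) x a = fderiv ℝ (fderiv ℝ θ) x a b := by
  have hD : DifferentiableAt ℝ (fderiv ℝ θ) x :=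
    ((hθ.fderiv_right (m := 1) (by norm_num)).differentiable (by norm_num)) x
  rw [fderiv_clm_apply hD (differentiableAt_const b)]
  simp

/-- Second derivative of the cross-section family along the fibre: `D²(sectionFun)(v)[(0,1)][(0,1)] = D²F₀(x)[Je][Je]`. -/
theorem fderiv_fderiv_sectionFun_fibre {F₀ : EuclideanSpace ℝ (Fin 3) → ℝ} (hF : ContDiff ℝ 2 F₀) (e : EuclideanSpace ℝ (Fin 3))
    (v : (ℝ × ℝ) × ℝ) :
    fderiv ℝ (fderiv ℝ (sectionFun F₀ e)) v ((0 : ℝ × ℝ), (1 : ℝ)) ((0 : ℝ × ℝ), (1 : ℝ)) =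
      fderiv ℝ (fderiv ℝ F₀) (frameCLM e (v.1.1, v.2, v.1.2)) (Jvec e) (Jvec e) := by
  have hF1 : Differentiable ℝ F₀ := hF.differentiable (by norm_num)
  have hDF : ∀ y, DifferentiableAt ℝ (fderiv ℝ F₀) y := fun y =>
    ((hF.fderiv_right (m := 1) (by norm_num)).differentiable (by norm_num)) y
  set M := (frameCLM e).comp reindex with hM
  have hsec : ContDiff ℝ 2 (sectionFun F₀ e) := by rw [sectionFun_eq]; exact hF.comp M.contDiff
  set w₀ : (ℝ × ℝ) × ℝ := ((0 : ℝ × ℝ), (1 : ℝ)) with hw₀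
  have hMw : M w₀ = Jvec e := by simp [hM, reindex_apply, frameCLM_apply, hw₀]
  have hMv : M v = frameCLM e (v.1.1, v.2, v.1.2) := by simp [hM, reindex_apply]
  -- `v ↦ D(sectionFun)(v)[w₀] = DF₀(M v)[Jvec e]`
  have hfun : (fun v' => fderiv ℝ (sectionFun F₀ e) v' w₀) = (fun y => fderiv ℝ F₀ y (Jvec e)) ∘ M := by
    funext v'
    rw [fderiv_sectionFun hF1]
    simp [hw₀, frameCLM_apply, hM, reindex_apply]
  rw [← nested_eq_fderiv_fderiv' hsec, ← nested_eq_fderiv_fderiv hF, hfun]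
  have hg : DifferentiableAt ℝ (fun y => fderiv ℝ F₀ y (Jvec e)) (M v) := (hDF _).clm_apply (differentiableAt_const _)
  have hc := hg.hasFDerivAt.comp v M.hasFDerivAt
  rw [hc.fderiv, ContinuousLinearMap.comp_apply, hMw, hMv]

/-- **`∂_νF₀ = 0` at the web point** (an interior maximum of the cross-section). -/
theorem fderiv_Jvec_webFun_eq_zero {F₀ : EuclideanSpace ℝ (Fin 3) → ℝ} (hF : Differentiable ℝ F₀) {e : EuclideanSpace ℝ (Fin 3)}
    {r δ : ℝ} {Rz : ℝ → ℝ}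
    (hS : ∀ z : ℝ, |z| < δ → ∀ s : ℝ, ∃ n₀ ∈ Ioo (-r) r, F₀ (frameCLM e (s, n₀, z)) = Rz z ∧
      ∀ n ∈ Icc (-r) r, n ≠ n₀ → F₀ (frameCLM e (s, n, z)) < Rz z)
    {p : ℝ × ℝ} (hp : |p.2| < δ) :
    fderiv ℝ F₀ (frameCLM e (p.1, webFun F₀ e r δ Rz hS p, p.2)) (Jvec e) = 0 := by
  obtain ⟨hmem, hval, huniq⟩ := webFun_spec hS hp
  set n₀ := webFun F₀ e r δ Rz hS p with hn₀
  -- the cross-section `g n = F₀(L(s,n,z))` has a local max at `n₀`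
  set g : ℝ → ℝ := fun n => F₀ (frameCLM e (p.1, n, p.2)) with hg
  have hmax : IsLocalMax g n₀ := by
    have hnhds : Ioo (-r) r ∈ 𝓝 n₀ := isOpen_Ioo.mem_nhds hmem
    filter_upwards [hnhds] with n hn
    by_cases hne : n = n₀
    · rw [hne]
    · have h := huniq n (Ioo_subset_Icc_self hn) hne
      rw [hg]; simp only; rw [hval]; exact h.le
  have hline : HasDerivAt (fun n : ℝ => frameCLM e (p.1, n, p.2)) (frameCLM e eN) n₀ := by
    have h1 : HasDerivAt (fun n : ℝ => ((p.1, n, p.2) : ℝ × ℝ × ℝ)) eN n₀ :=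
      (hasDerivAt_const n₀ p.1).prodMk ((hasDerivAt_id n₀).prodMk (hasDerivAt_const n₀ p.2))
    exact (frameCLM e).hasFDerivAt.comp_hasDerivAt n₀ h1
  have hgd : HasDerivAt g (fderiv ℝ F₀ (frameCLM e (p.1, n₀, p.2)) (frameCLM e eN)) n₀ :=
    (hF _).hasFDerivAt.comp_hasDerivAt n₀ hline
  have h0 := hmax.hasDerivAt_eq_zero hgd
  rwa [frameCLM_eN] at h0

/-- **The web function is `C^ω` on the window** (`…WebFunction.contDiffAt_criticalPoint`). -/
theorem contDiffAt_webFun {F₀ : EuclideanSpace ℝ (Fin 3) → ℝ} (hF : ContDiff ℝ ω F₀) {e : EuclideanSpace ℝ (Fin 3)}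
    {r δ : ℝ} {Rz : ℝ → ℝ}
    (hS : ∀ z : ℝ, |z| < δ → ∀ s : ℝ, ∃ n₀ ∈ Ioo (-r) r, F₀ (frameCLM e (s, n₀, z)) = Rz z ∧
      ∀ n ∈ Icc (-r) r, n ≠ n₀ → F₀ (frameCLM e (s, n, z)) < Rz z)
    (hconc : ∀ z : ℝ, |z| < δ → ∀ s : ℝ, ∀ n ∈ Ioo (-r) r,
      fderiv ℝ (fderiv ℝ F₀) (frameCLM e (s, n, z)) (Jvec e) (Jvec e) < 0)
    {p₀ : ℝ × ℝ} (hp₀ : |p₀.2| < δ) : ContDiffAt ℝ ω (webFun F₀ e r δ Rz hS) p₀ := by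
  have hF1 : Differentiable ℝ F₀ := hF.differentiable (by simp)
  have hF2 : ContDiff ℝ 2 F₀ := hF.of_le le_top
  set V : Set (ℝ × ℝ) := {p | |p.2| < δ} with hV
  have hVo : IsOpen V := isOpen_lt (continuous_abs.comp continuous_snd) continuous_const
  -- the cross-section family is `C^ω`
  have hsec : ContDiff ℝ ω (sectionFun F₀ e) := by
    rw [sectionFun_eq]; exact hF.comp ((frameCLM e).comp reindex).contDiff
  refine contDiffAt_criticalPoint (G := sectionFun F₀ e) hVo (r := r) (fun p _ n _ => hsec.contDiffAt) ?_ ?_ ?_ hp₀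
  · intro p hp n hn
    rw [fderiv_fderiv_sectionFun_fibre hF2]
    exact hconc p.2 hp p.1 n hn
  · exact fun p hp => (webFun_spec hS hp).1
  · intro p hp
    rw [fderiv_sectionFun hF1]
    have h := fderiv_Jvec_webFun_eq_zero hF1 hS hp
    rw [← frameCLM_eN] at h
    simpa [eN] using h

end Summit.NavierStokesRegularity.NavierStokesRegularity.Theorems.PoloidalWindowDoorLrcModEntireQ4LineWeb
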